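import Summits.PneNP.PneNP.Theorems.OneSliceConstantBandDefs
import Summits.PneNP.PneNP.Theorems.OneSliceConstantBandTransferStepAux

/-!
# Route OneSlice, crux `ConstantBand` (stmt-PneNP-2834), line `flat-prior-relative-minterms`:
# stub S5 `stub_transferStep` — the transfer `SliceLemma23 → BandPair → ConstantBandSchedule`

The registered stub `stub_transferStep : SliceLemma23 → BandPair → ConstantBandSchedule` of the skeleton
`Cruxes/ConstantBand/Lines/flat-prior-relative-minterms.lean`, in the vocabulary of
`Theorems/OneSliceConstantBandDefs.lean`; the counting toolkit (first moment on a slice, window asymptotics around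
`m_k(n)`) is `Theorems/OneSliceConstantBandTransferStepAux.lean`.

Proof (bookkeeping over two estimates). Given `c`, `BandPair` supplies `k ≥ 3`, `w`, `γ > 0`; `SliceLemma23 k`
supplies `L > 0`, applied at `ε = γ/2`; put `δ := min (γ²/(4L)) (1/6)`. Eventually in `n` (the two eventual
hypotheses and `ts_eventually_window`), for a central `j` and a monotone `C` with `bandErr ≤ δ`, suppose
`|C| ≤ n^c`. (i) For a lower-band slice `i`, both `i` and `i + C(k,2)` are band slices (`C(k,2) ≤ j`), the event
`C = 0 ∧ CLIQUE_k` on slice `i + C(k,2)` lies in the error set, so its fraction is `≤ bandErr ≤ δ` and the planted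
rejection on slice `i` is `≤ √(Lδ) + γ/2 ≤ γ`; summing, `BandPair` gives band rejection `< #band/2`. (ii) On every
band slice `P_i[C = 0] ≥ 1 − C(n,k)(i/C(n,2))^{C(k,2)} − errfrac_i ≥ 2/3 − errfrac_i`, so band rejection
`≥ (2/3)#band − δ ≥ #band/2` (`#band ≥ 1`, `δ ≤ 1/6`) — contradiction.
-/

set_option linter.dupNamespace false

namespace Summit.PneNP.PneNP.Cruxes.ConstantBand.FlatPriorRelativeMinterms

open Literature.Computability.Complexity Finset Filter Classical
open Summit.PneNP.PneNP.Theorems.ConstantBand.Negative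

/-- **The transfer with an explicit slice-Lemma-23 hypothesis.** If for every `k ≥ 3` there is a constant `L`
with `P_{(x,A)}[f(x ∪ K_A) = 0] ≤ √(L · P_{i+C(k,2)}[f = 0 ∧ CLIQUE_k]) + ε` on central bands (eventually, every
`f`), then `BandPair` implies the crux in schedule form, with the witness `δ = min (γ²/(4L)) (1/6)` for BandPair's
`(k, w, γ)`: a `δ`-accurate monotone circuit of size `≤ n^c` rejects at most `γ·#lowerBand` planted pairs
(each lower slice: `√(L·δ) + γ/2 ≤ γ`) yet at least half of the band (first moment `P_i[CLIQUE_k] ≤ 1/3` and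
accuracy `Σ errfrac ≤ 1/6`), contradicting `BandPair`. [folklore] -/
theorem ts_transfer_of_sliceL23
    (h₁ : ∀ k : ℕ, 3 ≤ k → ∃ L : ℝ, 0 < L ∧ ∀ w : ℕ, ∀ ε : ℝ, 0 < ε → ∀ᶠ n : ℕ in atTop, ∀ j : ℕ,
      Central k n j → ∀ i ∈ band j w, ∀ f : (Edge n → Bool) → Bool,
        pairProb n k i (fun x A => f (plantClique A x) = false) ≤
          Real.sqrt (L * sliceProb n (i + k.choose 2) (fun y => f y = false ∧ cliqueFn n k y = true)) + ε)
    (h₂ : BandPair) : ConstantBandSchedule := by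
  intro c
  obtain ⟨k, hk, w, γ, hγ, hE1⟩ := h₂ c
  obtain ⟨L, hL, hS1⟩ := h₁ k hk
  refine ⟨k, hk, w, min (γ ^ 2 / (4 * L)) (1 / 6), lt_min (by positivity) (by norm_num), ?_⟩
  set δ : ℝ := min (γ ^ 2 / (4 * L)) (1 / 6) with hδ
  filter_upwards [hE1, hS1 w (γ / 2) (half_pos hγ), ts_eventually_window k hk w] with n hBP hL23 hwin
  obtain ⟨hN, hwin⟩ := hwin
  intro j hj C hC herr
  obtain ⟨hKj, hwj⟩ := hwin j hj
  by_contra hsize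
  rw [not_lt] at hsize
  have hL0 : L ≠ 0 := hL.ne'
  -- every error fraction of `C` on the band is at most `bandErr ≤ δ`
  have hq : ∀ i ∈ band j w, (#(errSet n k i C) : ℝ) / #(slice n i) ≤ δ := fun i hi =>
    (single_le_sum (f := fun i => (#(errSet n k i C) : ℝ) / #(slice n i))
      (fun i _ => div_nonneg (Nat.cast_nonneg _) (Nat.cast_nonneg _)) hi).trans herr
  -- (i) planted rejection `≤ γ · #lowerBand`, so `BandPair` applies
  have hplanted : ∑ i ∈ lowerBand k j w, pairProb n k i (fun x A => C.eval (plantClique A x) = false) ≤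
      γ * #(lowerBand k j w) := by
    have hterm : ∀ i ∈ lowerBand k j w,
        pairProb n k i (fun x A => C.eval (plantClique A x) = false) ≤ γ := by
      intro i hi
      rw [lowerBand, mem_Icc] at hi
      have hib : i ∈ band j w := by rw [band, mem_Icc]; omega
      have hiK : i + k.choose 2 ∈ band j w := by rw [band, mem_Icc]; omega
      have h1 := hL23 j hj i hib C.eval
      have h2 : sliceProb n (i + k.choose 2) (fun y => C.eval y = false ∧ cliqueFn n k y = true) ≤
          (#(errSet n k (i + k.choose 2) C) : ℝ) / #(slice n (i + k.choose 2)) :=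
        ts_frac_false_clique_le_errFrac C
      have h3 : Real.sqrt (L * sliceProb n (i + k.choose 2)
          (fun y => C.eval y = false ∧ cliqueFn n k y = true)) ≤ γ / 2 := by
        rw [Real.sqrt_le_left (by positivity)]
        calc L * sliceProb n (i + k.choose 2) (fun y => C.eval y = false ∧ cliqueFn n k y = true)
            ≤ L * (γ ^ 2 / (4 * L)) :=
              mul_le_mul_of_nonneg_left ((h2.trans (hq _ hiK)).trans (min_le_left _ _)) hL.le
          _ = (γ / 2) ^ 2 := by field_simp; ring
      linarith
    calc ∑ i ∈ lowerBand k j w, pairProb n k i (fun x A => C.eval (plantClique A x) = false)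
        ≤ ∑ _i ∈ lowerBand k j w, γ := sum_le_sum hterm
      _ = γ * #(lowerBand k j w) := by rw [sum_const, nsmul_eq_mul, mul_comm]
  have hlt := hBP j hj C hC hsize hplanted
  -- (ii) band rejection `≥ #band / 2`: first moment and accuracy
  have hge : (1 / 2 : ℝ) * #(band j w) ≤ ∑ i ∈ band j w, sliceProb n i (fun x => C.eval x = false) := by
    have hterm : ∀ i ∈ band j w, (2 / 3 : ℝ) - (#(errSet n k i C) : ℝ) / #(slice n i) ≤
        sliceProb n i (fun x => C.eval x = false) := by
      intro i hi
      have hijw : i ≤ j + w := by rw [band, mem_Icc] at hi; exact hi.2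
      obtain ⟨hiN, hmom⟩ := hwj i hijw
      have h : 1 - (n.choose k : ℝ) * ((i : ℝ) / n.choose 2) ^ k.choose 2 -
          (#(errSet n k i C) : ℝ) / #(slice n i) ≤ sliceProb n i (fun x => C.eval x = false) :=
        ts_one_sub_le_frac_false C hiN hN
      linarith
    have hsum := sum_le_sum hterm
    rw [sum_sub_distrib, sum_const, nsmul_eq_mul] at hsum
    have hband : (1 : ℝ) ≤ #(band j w) := by
      have : 0 < #(band j w) := card_pos.2 ⟨j, by rw [band, mem_Icc]; omega⟩
      exact_mod_cast this
    have herr' : ∑ i ∈ band j w, (#(errSet n k i C) : ℝ) / #(slice n i) ≤ 1 / 6 :=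
      herr.trans (min_le_right _ _)
    linarith
  exact absurd hlt (not_lt.2 hge)

/-- The `k! + 1 + ε` form of slice Lemma 23 gives the constant form with `L = k! + 2` (take `ε ≤ 1`). [folklore] -/
theorem ts_sliceL23_const_of_factorial
    (h : ∀ k : ℕ, 3 ≤ k → ∀ w : ℕ, ∀ ε : ℝ, 0 < ε → ∀ᶠ n : ℕ in atTop, ∀ j : ℕ, Central k n j →
      ∀ i ∈ band j w, ∀ f : (Edge n → Bool) → Bool,
        pairProb n k i (fun x A => f (plantClique A x) = false) ≤
          Real.sqrt (((k.factorial : ℝ) + 1 + ε) *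
              sliceProb n (i + k.choose 2) (fun y => f y = false ∧ cliqueFn n k y = true)) + ε) :
    ∀ k : ℕ, 3 ≤ k → ∃ L : ℝ, 0 < L ∧ ∀ w : ℕ, ∀ ε : ℝ, 0 < ε → ∀ᶠ n : ℕ in atTop, ∀ j : ℕ,
      Central k n j → ∀ i ∈ band j w, ∀ f : (Edge n → Bool) → Bool,
        pairProb n k i (fun x A => f (plantClique A x) = false) ≤
          Real.sqrt (L * sliceProb n (i + k.choose 2) (fun y => f y = false ∧ cliqueFn n k y = true)) + ε := by
  intro k hk
  refine ⟨(k.factorial : ℝ) + 2, by positivity, fun w ε hε => ?_⟩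
  filter_upwards [h k hk w (min ε 1) (lt_min hε one_pos)] with n hn j hj i hi f
  refine (hn j hj i hi f).trans (add_le_add (Real.sqrt_le_sqrt (mul_le_mul_of_nonneg_right ?_ ?_))
    (min_le_left _ _))
  · linarith [min_le_right ε 1]
  · exact div_nonneg (Nat.cast_nonneg _) (Nat.cast_nonneg _)

/-- **S5 · stub `stub_transferStep`: the transfer `BandPair → ConstantBand` in schedule form, modulo slice
Lemma 23.** Given `c`, take BandPair's `(k, w, γ)`, the constant `L = L(k)` of `SliceLemma23` and
`δ := min (γ²/(4L)) (1/6)`; for a `δ`-accurate monotone `C` of size `≤ n^c` on a central band (eventually in `n`):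
(i) each lower-band slice has planted rejection `≤ √(L·δ) + γ/2 ≤ γ` (`SliceLemma23` at `ε = γ/2`; the event
`C = 0 ∧ CLIQUE_k` on slice `i + C(k,2)` lies in the error set, whose fraction is `≤ bandErr ≤ δ`), so `BandPair`
yields band rejection `< #band/2`; (ii) but on every band slice `P_i[C = 0] ≥ 1 − P_i[CLIQUE_k] − errfrac_i ≥ 2/3 −
errfrac_i` (first moment `C(n,k)(i/C(n,2))^{C(k,2)} ≤ 2/k! ≤ 1/3` on the central window), so band rejection
`≥ (2/3)#band − 1/6 ≥ #band/2` — contradiction, hence `n^c < |C|`. [folklore] -/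
theorem stub_transferStep : SliceLemma23 → BandPair → ConstantBandSchedule :=
  ts_transfer_of_sliceL23

end Summit.PneNP.PneNP.Cruxes.ConstantBand.FlatPriorRelativeMinterms
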